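import Summits.QuantumFields.YangMills.Theorems.BalabanLadderUVSeamRecCarrierFlatGlue
import Summits.QuantumFields.YangMills.Theorems.BalabanLadderUVSeamRecCarrierFlatWindow
import HarnessLib

/-!
# Crux `UVSeamRec` (stmt-QuantumFields-20043), line `coldwall_pure` (RESHAPE 4, sha 05ceee0fa3dc7504): reductions of the registered
# tail stub `stub_classicalMomentsFemtoTail` (:130) — family form, constants monotonicity, and the Jensen KILL CRITERION on the tail

Helper file (`--supports stmt-QuantumFields-20043`) of seat `ymfull-r2d-prover-3` (hand on stub :130).  The registered stub (CM-tail) ≡ (EM♭-tail) reads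
«`∃ C > 0, B, β₁, ℓ₁ > 0` such that for `β ≥ β₁`, every odd torus `(ℤ/(2L+1))⁴`, every scale `R ≥ 1` on the femto TAIL `⌈β^{1/9}⌉ ≤ R + 2`,
`R·uRec β ≤ ℓ₁`, `4R + 8 ≤ L`, every cyclically `2R+4`-separated family `(qᵢ, xᵢ)_{i<n}` and every sub-family `T`:
`⟨exp(2 Σ_{i∈T} carrierCl rF C 1 1 R (q i) (x i))⟩_{2L+1,β} ≤ exp(B·#T)`» — joint exponential moments of the β-FREE classical centre responses
`carrierCl rF C 1 1 R = R⁴·cr/C` (`…ClassicalResponseDefs`).  This file records three elementary facts about that SENTENCE (no claim on its truth):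

* §1 `classicalMomentsFemtoTail_iff_family` — the quantifier `∀ T` is REDUNDANT: a sub-family of a separated family is a separated family (re-index
  `T ≃ Fin #T`), so the stub is equivalent to its `T = univ` form «`⟨exp(2 Σ_{i<n} carrierCl …)⟩ ≤ exp(B·n)` for every separated family».
* §2 `classicalMomentsFemtoTail_mono` — constants can only be RELAXED: truth at `(C, B, β₁, ℓ₁)` gives truth at every `C' ≥ C`, `B' ≥ B`, `β₁' ≥ β₁`,
  `0 < ℓ₁' ≤ ℓ₁` (the carrier is non-negative and antitone in `C`).
* §3 `not_classicalMomentsFemtoTail_of_flatCarrierMean_unbounded` — the KILL CRITERION for the disprover, flat and tail-only (the analogue of LEAD g18's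
  bare-carrier criteria p646638): by Jensen (`torusE_carrierCl_one_le_of_expMomentsFlat`) the stub bounds the torus MEAN of the unit flat carrier,
  `⟨R⁴·cr⟩_{2L+1,β} ≤ C·B/2`, at every admissible `(β, R, L, q, x)` of the tail; hence an UNBOUNDED unit flat-carrier mean along admissible tail points
  (for every onset `β₁` and every window `ℓ₁ > 0`) refutes the stub for every choice of constants.  Heuristically (one-loop running, FINDING-20043-g18 §2)
  `⟨R⁴cr⟩ ≍ κ·g²(R) ≤ κ·g²_phys(ℓ₁)` IS bounded on the tail, so the criterion is a formal target, not an expectation of failure.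

HONEST FRAMING: bookkeeping on an OPEN conditional binder (XL: Gaussian concentration of the classical centre response at RUNNING coupling on scales up to
`ℓ₁·e^{β/(4b₀)}`); nothing of E0′, NT or a gap is claimed; finite-volume/conditional; the Yang–Mills mass gap is NOT proved; not Clay.
-/

noncomputable section

open MeasureTheory Filter Topology Finset
open Literature.MathematicalPhysics.QuantumFieldTheory (GaugeConfig LatticeRep)
open Literature.MathematicalPhysics.QuantumLattice (fundamentalRep fundamentalLatticeRep LGConfig)
open Summit.QuantumFields.YangMills.Cruxes.OSLegsFromFemtoAndGap.DlrCollarTransfer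
open Summit.QuantumFields.YangMills.Cruxes.UVSeamRec
open Summit.QuantumFields.YangMills.Cruxes.UVSeamRec.ClassicalResponse
open Summit.QuantumFields.YangMills.Cruxes.UVSeamRec.ResponsePinning (torusE_mono)

namespace Summit.QuantumFields.YangMills.Cruxes.UVSeamRec.ClassicalResponse.ColdWall

/-! ### §1 The sub-family quantifier is redundant -/

/-- **A sub-family of a cyclically separated family is a cyclically separated family** (re-indexing along `T ≃ Fin #T`), and the sub-family sum is the
re-indexed full sum.  Packaged as: the `T = univ` form of an exponential-moment bound for separated families at `(β, R, L)` gives the `∀ T` form. [folklore] -/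
theorem torusE_exp_sum_le_of_family {β C B : ℝ} {L R : ℕ}
    (hfam : ∀ (n : ℕ) (q : Fin n → Fin 4 × Fin 4) (x : Fin n → (Fin 4 → ℤ)), (∀ i, (q i).1 < (q i).2) →
      (∀ i j : Fin n, i ≠ j → ∃ k : Fin 4,
        (2 * (R : ℤ) + 4) ≤ |((((x i k - x j k : ℤ) : ZMod (2 * L + 1))).valMinAbs : ℤ)|) →
        torusE (Matrix.specialUnitaryGroup (Fin 2) ℂ) (fundamentalLatticeRep 2) β L
          (fun U => Real.exp (((2 : ℕ) : ℝ) * ∑ i, carrierCl (fundamentalLatticeRep 2) C 1 1 R (q i) (x i) U)) ≤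
          Real.exp (B * n))
    {n : ℕ} (q : Fin n → Fin 4 × Fin 4) (x : Fin n → (Fin 4 → ℤ)) (hq : ∀ i, (q i).1 < (q i).2)
    (hsep : ∀ i j : Fin n, i ≠ j → ∃ k : Fin 4,
      (2 * (R : ℤ) + 4) ≤ |((((x i k - x j k : ℤ) : ZMod (2 * L + 1))).valMinAbs : ℤ)|)
    (T : Finset (Fin n)) :
    torusE (Matrix.specialUnitaryGroup (Fin 2) ℂ) (fundamentalLatticeRep 2) β L
        (fun U => Real.exp (((2 : ℕ) : ℝ) * ∑ i ∈ T, carrierCl (fundamentalLatticeRep 2) C 1 1 R (q i) (x i) U)) ≤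
      Real.exp (B * T.card) := by
  set e : ↥T ≃ Fin T.card := T.equivFin with he
  have hq' : ∀ j : Fin T.card, (q (e.symm j).1).1 < (q (e.symm j).1).2 := fun j => hq _
  have hsep' : ∀ j j' : Fin T.card, j ≠ j' → ∃ k : Fin 4,
      (2 * (R : ℤ) + 4) ≤ |((((x (e.symm j).1 k - x (e.symm j').1 k : ℤ) : ZMod (2 * L + 1))).valMinAbs : ℤ)| :=
    fun j j' hjj' => hsep _ _ fun h => hjj' (e.symm.injective (Subtype.val_injective h))
  have hsum : ∀ U : LGConfig 4 (Matrix.specialUnitaryGroup (Fin 2) ℂ),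
      ∑ i ∈ T, carrierCl (fundamentalLatticeRep 2) C 1 1 R (q i) (x i) U =
        ∑ j, carrierCl (fundamentalLatticeRep 2) C 1 1 R (q (e.symm j).1) (x (e.symm j).1) U := by
    intro U
    rw [← Finset.sum_coe_sort T]
    exact (Equiv.sum_comp e.symm (fun i : ↥T => carrierCl (fundamentalLatticeRep 2) C 1 1 R (q i.1) (x i.1) U)).symm
  have h := hfam T.card (fun j => q (e.symm j).1) (fun j => x (e.symm j).1) hq' hsep'
  simp_rw [hsum]
  exact h

/-- **(CM-tail) ⟺ its `T = univ` (family) form.**  The registered sentence of `stub_classicalMomentsFemtoTail` is equivalent to the same sentence with the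
sub-family quantifier dropped: «for every separated family, `⟨exp(2 Σ_{i<n} carrierCl rF C 1 1 R (q i) (x i))⟩_{2L+1,β} ≤ exp(B·n)`». [folklore] -/
theorem classicalMomentsFemtoTail_iff_family :
    (∃ (C B β₁ ℓ₁ : ℝ), 0 < C ∧ 0 < ℓ₁ ∧
      ∀ β : ℝ, β₁ ≤ β → ∀ (L n : ℕ) (q : Fin n → Fin 4 × Fin 4) (x : Fin n → (Fin 4 → ℤ)) (R : ℕ),
      (∀ i, (q i).1 < (q i).2) → 1 ≤ R → ⌈β ^ (1 / 9 : ℝ)⌉₊ ≤ R + 2 → (R : ℝ) * Transport.uRec β ≤ ℓ₁ → 4 * R + 8 ≤ L →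
      (∀ i j : Fin n, i ≠ j → ∃ k : Fin 4,
        (2 * (R : ℤ) + 4) ≤ |((((x i k - x j k : ℤ) : ZMod (2 * L + 1))).valMinAbs : ℤ)|) →
      ∀ T : Finset (Fin n),
        torusE (Matrix.specialUnitaryGroup (Fin 2) ℂ) (fundamentalLatticeRep 2) β L
          (fun U => Real.exp (((2 : ℕ) : ℝ) * ∑ i ∈ T, carrierCl (fundamentalLatticeRep 2) C 1 1 R (q i) (x i) U)) ≤
          Real.exp (B * T.card)) ↔
    (∃ (C B β₁ ℓ₁ : ℝ), 0 < C ∧ 0 < ℓ₁ ∧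
      ∀ β : ℝ, β₁ ≤ β → ∀ (L n : ℕ) (q : Fin n → Fin 4 × Fin 4) (x : Fin n → (Fin 4 → ℤ)) (R : ℕ),
      (∀ i, (q i).1 < (q i).2) → 1 ≤ R → ⌈β ^ (1 / 9 : ℝ)⌉₊ ≤ R + 2 → (R : ℝ) * Transport.uRec β ≤ ℓ₁ → 4 * R + 8 ≤ L →
      (∀ i j : Fin n, i ≠ j → ∃ k : Fin 4,
        (2 * (R : ℤ) + 4) ≤ |((((x i k - x j k : ℤ) : ZMod (2 * L + 1))).valMinAbs : ℤ)|) →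
        torusE (Matrix.specialUnitaryGroup (Fin 2) ℂ) (fundamentalLatticeRep 2) β L
          (fun U => Real.exp (((2 : ℕ) : ℝ) * ∑ i, carrierCl (fundamentalLatticeRep 2) C 1 1 R (q i) (x i) U)) ≤
          Real.exp (B * n)) := by
  constructor
  · rintro ⟨C, B, β₁, ℓ₁, hC, hℓ₁, h⟩
    refine ⟨C, B, β₁, ℓ₁, hC, hℓ₁, fun β hβ L n q x R hq hR htl hRu hRL hsep => ?_⟩
    simpa using h β hβ L n q x R hq hR htl hRu hRL hsep Finset.univ
  · rintro ⟨C, B, β₁, ℓ₁, hC, hℓ₁, h⟩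
    refine ⟨C, B, β₁, ℓ₁, hC, hℓ₁, fun β hβ L n q x R hq hR htl hRu hRL hsep T => ?_⟩
    exact torusE_exp_sum_le_of_family (fun n q x hq hsep => h β hβ L n q x R hq hR htl hRu hRL hsep) q x hq hsep T

/-! ### §2 Constants can only be relaxed -/

/-- **Monotonicity of (CM-tail) in its constants**: if the tail bound holds at `(C, B, β₁, ℓ₁)` then it holds at every `C' ≥ C` (the carrier
`R⁴cr/C` is non-negative and antitone in `C`), `B' ≥ B`, `β₁' ≥ β₁`, `0 < ℓ₁' ≤ ℓ₁`. [folklore] -/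
theorem classicalMomentsFemtoTail_mono {C B β₁ ℓ₁ C' B' β₁' ℓ₁' : ℝ} (hC : 0 < C) (hCC : C ≤ C') (hBB : B ≤ B') (hβ : β₁ ≤ β₁')
    (hℓ₁' : 0 < ℓ₁') (hℓℓ : ℓ₁' ≤ ℓ₁)
    (h : ∀ β : ℝ, β₁ ≤ β → ∀ (L n : ℕ) (q : Fin n → Fin 4 × Fin 4) (x : Fin n → (Fin 4 → ℤ)) (R : ℕ),
      (∀ i, (q i).1 < (q i).2) → 1 ≤ R → ⌈β ^ (1 / 9 : ℝ)⌉₊ ≤ R + 2 → (R : ℝ) * Transport.uRec β ≤ ℓ₁ → 4 * R + 8 ≤ L →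
      (∀ i j : Fin n, i ≠ j → ∃ k : Fin 4,
        (2 * (R : ℤ) + 4) ≤ |((((x i k - x j k : ℤ) : ZMod (2 * L + 1))).valMinAbs : ℤ)|) →
      ∀ T : Finset (Fin n),
        torusE (Matrix.specialUnitaryGroup (Fin 2) ℂ) (fundamentalLatticeRep 2) β L
          (fun U => Real.exp (((2 : ℕ) : ℝ) * ∑ i ∈ T, carrierCl (fundamentalLatticeRep 2) C 1 1 R (q i) (x i) U)) ≤
          Real.exp (B * T.card)) :
    0 < C' ∧ 0 < ℓ₁' ∧
    ∀ β : ℝ, β₁' ≤ β → ∀ (L n : ℕ) (q : Fin n → Fin 4 × Fin 4) (x : Fin n → (Fin 4 → ℤ)) (R : ℕ),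
      (∀ i, (q i).1 < (q i).2) → 1 ≤ R → ⌈β ^ (1 / 9 : ℝ)⌉₊ ≤ R + 2 → (R : ℝ) * Transport.uRec β ≤ ℓ₁' → 4 * R + 8 ≤ L →
      (∀ i j : Fin n, i ≠ j → ∃ k : Fin 4,
        (2 * (R : ℤ) + 4) ≤ |((((x i k - x j k : ℤ) : ZMod (2 * L + 1))).valMinAbs : ℤ)|) →
      ∀ T : Finset (Fin n),
        torusE (Matrix.specialUnitaryGroup (Fin 2) ℂ) (fundamentalLatticeRep 2) β L
          (fun U => Real.exp (((2 : ℕ) : ℝ) * ∑ i ∈ T, carrierCl (fundamentalLatticeRep 2) C' 1 1 R (q i) (x i) U)) ≤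
          Real.exp (B' * T.card) := by
  set rF : LatticeRep (Matrix.specialUnitaryGroup (Fin 2) ℂ) := fundamentalLatticeRep 2 with hrF
  have hC' : 0 < C' := hC.trans_le hCC
  refine ⟨hC', hℓ₁', fun β hβ' L n q x R hq hR htl hRu hRL hsep T => ?_⟩
  have h0 := h β (hβ.trans hβ') L n q x R hq hR htl (hRu.trans hℓℓ) hRL hsep T
  have hT : (0 : ℝ) ≤ T.card := Nat.cast_nonneg _
  -- pointwise: the carrier at `C'` is below the carrier at `C`
  have hpt : ∀ U : LGConfig 4 (Matrix.specialUnitaryGroup (Fin 2) ℂ),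
      Real.exp (((2 : ℕ) : ℝ) * ∑ i ∈ T, carrierCl rF C' 1 1 R (q i) (x i) U) ≤
        Real.exp (((2 : ℕ) : ℝ) * ∑ i ∈ T, carrierCl rF C 1 1 R (q i) (x i) U) := by
    intro U
    refine Real.exp_le_exp.2 (mul_le_mul_of_nonneg_left (Finset.sum_le_sum fun i _ => ?_) (by positivity))
    unfold carrierCl
    have hcr := classicalResponse_nonneg (r := rF) (fun k => x i k - ((R : ℤ) + 1)) (2 * R + 3) (q i) (x i) one_pos U
    have hfrac : (1 : ℝ) * (R : ℝ) ^ 4 / C' ≤ 1 * (R : ℝ) ^ 4 / C :=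
      div_le_div_of_nonneg_left (by positivity) hC hCC
    exact mul_le_mul_of_nonneg_right hfrac hcr
  have hcont : ∀ C₀ : ℝ, Continuous fun U : LGConfig 4 (Matrix.specialUnitaryGroup (Fin 2) ℂ) =>
      Real.exp (((2 : ℕ) : ℝ) * ∑ i ∈ T, carrierCl rF C₀ 1 1 R (q i) (x i) U) := fun C₀ =>
    Real.continuous_exp.comp (continuous_const.mul (continuous_finsetSum _ fun i _ =>
      continuous_const.mul (continuous_classicalResponse (r := rF) _ _ (q i) (x i) 1)))
  calc torusE (Matrix.specialUnitaryGroup (Fin 2) ℂ) rF β L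
          (fun U => Real.exp (((2 : ℕ) : ℝ) * ∑ i ∈ T, carrierCl rF C' 1 1 R (q i) (x i) U))
      ≤ torusE (Matrix.specialUnitaryGroup (Fin 2) ℂ) rF β L
          (fun U => Real.exp (((2 : ℕ) : ℝ) * ∑ i ∈ T, carrierCl rF C 1 1 R (q i) (x i) U)) :=
        torusE_mono rF β L (hcont C') (hcont C) hpt
    _ ≤ Real.exp (B * T.card) := h0
    _ ≤ Real.exp (B' * T.card) := Real.exp_le_exp.2 (mul_le_mul_of_nonneg_right hBB hT)

/-! ### §3 The Jensen kill criterion on the tail -/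

/-- **(CM-tail) bounds the unit flat-carrier MEAN on the tail** (Jensen, `torusE_carrierCl_one_le_of_expMomentsFlat`): if the registered tail sentence holds
with constants `(C, B, β₁, ℓ₁)`, then at every admissible tail point `⟨carrierCl rF 1 1 1 R q x⟩_{2L+1,β} = ⟨R⁴·cr⟩ ≤ C·B/2`. [folklore] -/
theorem torusE_unitFlatCarrier_le_of_classicalMomentsFemtoTail {C B β₁ ℓ₁ : ℝ} (hC : 0 < C)
    (h : ∀ β : ℝ, β₁ ≤ β → ∀ (L n : ℕ) (q : Fin n → Fin 4 × Fin 4) (x : Fin n → (Fin 4 → ℤ)) (R : ℕ),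
      (∀ i, (q i).1 < (q i).2) → 1 ≤ R → ⌈β ^ (1 / 9 : ℝ)⌉₊ ≤ R + 2 → (R : ℝ) * Transport.uRec β ≤ ℓ₁ → 4 * R + 8 ≤ L →
      (∀ i j : Fin n, i ≠ j → ∃ k : Fin 4,
        (2 * (R : ℤ) + 4) ≤ |((((x i k - x j k : ℤ) : ZMod (2 * L + 1))).valMinAbs : ℤ)|) →
      ∀ T : Finset (Fin n),
        torusE (Matrix.specialUnitaryGroup (Fin 2) ℂ) (fundamentalLatticeRep 2) β L
          (fun U => Real.exp (((2 : ℕ) : ℝ) * ∑ i ∈ T, carrierCl (fundamentalLatticeRep 2) C 1 1 R (q i) (x i) U)) ≤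
          Real.exp (B * T.card))
    {β : ℝ} (hβ : β₁ ≤ β) {L R : ℕ} (hR : 1 ≤ R) (htl : ⌈β ^ (1 / 9 : ℝ)⌉₊ ≤ R + 2) (hRu : (R : ℝ) * Transport.uRec β ≤ ℓ₁)
    (hRL : 4 * R + 8 ≤ L) (q : Fin 4 × Fin 4) (hq : q.1 < q.2) (x : Fin 4 → ℤ) :
    torusE (Matrix.specialUnitaryGroup (Fin 2) ℂ) (fundamentalLatticeRep 2) β L
        (carrierCl (fundamentalLatticeRep 2) 1 1 1 R q x) ≤ C * B / 2 :=
  torusE_carrierCl_one_le_of_expMomentsFlat hC q x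
    (fun n q x hq hsep T => h β hβ L n q x R hq hR htl hRu hRL hsep T) hq

/-- **KILL CRITERION for `stub_classicalMomentsFemtoTail` (flat, tail-only).**  If the torus mean of the UNIT flat carrier `⟨R⁴·cr⟩_{2L+1,β}` is
UNBOUNDED along admissible tail points — for every bound `M`, every onset `β₁` and every window `ℓ₁ > 0` there are `β ≥ β₁`, a scale `R ≥ 1` with
`⌈β^{1/9}⌉ ≤ R + 2`, `R·uRec β ≤ ℓ₁`, a torus `L ≥ 4R + 8` and a plaquette `(x, q)` with `⟨carrierCl rF 1 1 1 R q x⟩_{2L+1,β} > M` — then the registered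
tail sentence is FALSE for every choice of its constants.  (Heuristically `⟨R⁴cr⟩ ≍ κ g²(R) ≤ κ g²_phys(ℓ₁)` is bounded on the tail: a formal target for the
disprover, not a prediction.) [folklore] -/
theorem not_classicalMomentsFemtoTail_of_flatCarrierMean_unbounded
    (hunb : ∀ (M β₁ ℓ₁ : ℝ), 0 < ℓ₁ → ∃ β : ℝ, β₁ ≤ β ∧ ∃ (L R : ℕ) (q : Fin 4 × Fin 4) (x : Fin 4 → ℤ),
      q.1 < q.2 ∧ 1 ≤ R ∧ ⌈β ^ (1 / 9 : ℝ)⌉₊ ≤ R + 2 ∧ (R : ℝ) * Transport.uRec β ≤ ℓ₁ ∧ 4 * R + 8 ≤ L ∧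
      M < torusE (Matrix.specialUnitaryGroup (Fin 2) ℂ) (fundamentalLatticeRep 2) β L
        (carrierCl (fundamentalLatticeRep 2) 1 1 1 R q x)) :
    ¬ (∃ (C B β₁ ℓ₁ : ℝ), 0 < C ∧ 0 < ℓ₁ ∧
      ∀ β : ℝ, β₁ ≤ β → ∀ (L n : ℕ) (q : Fin n → Fin 4 × Fin 4) (x : Fin n → (Fin 4 → ℤ)) (R : ℕ),
      (∀ i, (q i).1 < (q i).2) → 1 ≤ R → ⌈β ^ (1 / 9 : ℝ)⌉₊ ≤ R + 2 → (R : ℝ) * Transport.uRec β ≤ ℓ₁ → 4 * R + 8 ≤ L →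
      (∀ i j : Fin n, i ≠ j → ∃ k : Fin 4,
        (2 * (R : ℤ) + 4) ≤ |((((x i k - x j k : ℤ) : ZMod (2 * L + 1))).valMinAbs : ℤ)|) →
      ∀ T : Finset (Fin n),
        torusE (Matrix.specialUnitaryGroup (Fin 2) ℂ) (fundamentalLatticeRep 2) β L
          (fun U => Real.exp (((2 : ℕ) : ℝ) * ∑ i ∈ T, carrierCl (fundamentalLatticeRep 2) C 1 1 R (q i) (x i) U)) ≤
          Real.exp (B * T.card)) := by
  rintro ⟨C, B, β₁, ℓ₁, hC, hℓ₁, h⟩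
  obtain ⟨β, hβ, L, R, q, x, hq, hR, htl, hRu, hRL, hM⟩ := hunb (C * B / 2) β₁ ℓ₁ hℓ₁
  have hle := torusE_unitFlatCarrier_le_of_classicalMomentsFemtoTail hC h hβ hR htl hRu hRL q hq x
  linarith

/-! ### §4 (appended) The tail guard `β^{1/9}` is arbitrary: any exponent `0 < θ < 1/8` gives an EQUIVALENT stub -/

/-- **Guard transfer.**  If the (CM) tail sentence holds with guard `⌈β^{θ₁}⌉ ≤ R + 2` (`0 < θ₁ < 1/8`), then it holds with guard `⌈β^{θ₂}⌉ ≤ R + 2`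
for ANY `θ₂` (budget `max B 1`, later onset): a scale on the `θ₂`-tail is either on the `θ₁`-tail (hypothesis) or satisfies `R + 2 ≤ ⌈β^{θ₁}⌉`, where
LEAD g18's window theorem `expMomentsFlat_window` (any `C`, budget `1`) applies. [folklore] -/
theorem classicalMomentsFemtoTail_guard_transfer {θ₁ : ℝ} (hθ₁ : 0 < θ₁) (hθ₁₈ : θ₁ < 1 / 8) (θ₂ : ℝ)
    (h : ∃ (C B β₁ ℓ₁ : ℝ), 0 < C ∧ 0 < ℓ₁ ∧
      ∀ β : ℝ, β₁ ≤ β → ∀ (L n : ℕ) (q : Fin n → Fin 4 × Fin 4) (x : Fin n → (Fin 4 → ℤ)) (R : ℕ),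
      (∀ i, (q i).1 < (q i).2) → 1 ≤ R → ⌈β ^ θ₁⌉₊ ≤ R + 2 → (R : ℝ) * Transport.uRec β ≤ ℓ₁ → 4 * R + 8 ≤ L →
      (∀ i j : Fin n, i ≠ j → ∃ k : Fin 4,
        (2 * (R : ℤ) + 4) ≤ |((((x i k - x j k : ℤ) : ZMod (2 * L + 1))).valMinAbs : ℤ)|) →
      ∀ T : Finset (Fin n),
        torusE (Matrix.specialUnitaryGroup (Fin 2) ℂ) (fundamentalLatticeRep 2) β L
          (fun U => Real.exp (((2 : ℕ) : ℝ) * ∑ i ∈ T, carrierCl (fundamentalLatticeRep 2) C 1 1 R (q i) (x i) U)) ≤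
          Real.exp (B * T.card)) :
    ∃ (C B β₁ ℓ₁ : ℝ), 0 < C ∧ 0 < ℓ₁ ∧
      ∀ β : ℝ, β₁ ≤ β → ∀ (L n : ℕ) (q : Fin n → Fin 4 × Fin 4) (x : Fin n → (Fin 4 → ℤ)) (R : ℕ),
      (∀ i, (q i).1 < (q i).2) → 1 ≤ R → ⌈β ^ θ₂⌉₊ ≤ R + 2 → (R : ℝ) * Transport.uRec β ≤ ℓ₁ → 4 * R + 8 ≤ L →
      (∀ i j : Fin n, i ≠ j → ∃ k : Fin 4,
        (2 * (R : ℤ) + 4) ≤ |((((x i k - x j k : ℤ) : ZMod (2 * L + 1))).valMinAbs : ℤ)|) →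
      ∀ T : Finset (Fin n),
        torusE (Matrix.specialUnitaryGroup (Fin 2) ℂ) (fundamentalLatticeRep 2) β L
          (fun U => Real.exp (((2 : ℕ) : ℝ) * ∑ i ∈ T, carrierCl (fundamentalLatticeRep 2) C 1 1 R (q i) (x i) U)) ≤
          Real.exp (B * T.card) := by
  obtain ⟨C, B, β₁, ℓ₁, hC, hℓ₁, h⟩ := h
  obtain ⟨βw, -, hw⟩ := expMomentsFlat_window hθ₁ hθ₁₈ hC one_pos
  refine ⟨C, max B 1, max β₁ βw, ℓ₁, hC, hℓ₁, fun β hβ L n q x R hq hR _ hRu hRL hsep T => ?_⟩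
  have hT : (0 : ℝ) ≤ T.card := Nat.cast_nonneg _
  by_cases htl : ⌈β ^ θ₁⌉₊ ≤ R + 2
  · refine (h β ((le_max_left _ _).trans hβ) L n q x R hq hR htl hRu hRL hsep T).trans (Real.exp_le_exp.2 ?_)
    exact mul_le_mul_of_nonneg_right (le_max_left _ _) hT
  · push Not at htl
    refine (hw β ((le_max_right _ _).trans hβ) L n q x R hq hR (by omega) hRL hsep T).trans (Real.exp_le_exp.2 ?_)
    exact mul_le_mul_of_nonneg_right (le_max_right _ _) hT

/-- **(CM-tail) ⟺ (CM-tail with ANY guard `β^θ`, `0 < θ < 1/8`).**  The registered guard exponent `1/9` of `stub_classicalMomentsFemtoTail` is arbitrary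
below `1/8`: the stub is EQUIVALENT to the same sentence on the smaller tail `⌈β^θ⌉ ≤ R + 2` for every `θ < 1/8` (two guard transfers).  So the honest open
range of :130 is `R ≳ β^{1/8−}` (up to `ℓ₁/uRec β`). [folklore] -/
theorem classicalMomentsFemtoTail_iff_guard {θ : ℝ} (hθ : 0 < θ) (hθ₈ : θ < 1 / 8) :
    (∃ (C B β₁ ℓ₁ : ℝ), 0 < C ∧ 0 < ℓ₁ ∧
      ∀ β : ℝ, β₁ ≤ β → ∀ (L n : ℕ) (q : Fin n → Fin 4 × Fin 4) (x : Fin n → (Fin 4 → ℤ)) (R : ℕ),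
      (∀ i, (q i).1 < (q i).2) → 1 ≤ R → ⌈β ^ (1 / 9 : ℝ)⌉₊ ≤ R + 2 → (R : ℝ) * Transport.uRec β ≤ ℓ₁ → 4 * R + 8 ≤ L →
      (∀ i j : Fin n, i ≠ j → ∃ k : Fin 4,
        (2 * (R : ℤ) + 4) ≤ |((((x i k - x j k : ℤ) : ZMod (2 * L + 1))).valMinAbs : ℤ)|) →
      ∀ T : Finset (Fin n),
        torusE (Matrix.specialUnitaryGroup (Fin 2) ℂ) (fundamentalLatticeRep 2) β L
          (fun U => Real.exp (((2 : ℕ) : ℝ) * ∑ i ∈ T, carrierCl (fundamentalLatticeRep 2) C 1 1 R (q i) (x i) U)) ≤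
          Real.exp (B * T.card)) ↔
    (∃ (C B β₁ ℓ₁ : ℝ), 0 < C ∧ 0 < ℓ₁ ∧
      ∀ β : ℝ, β₁ ≤ β → ∀ (L n : ℕ) (q : Fin n → Fin 4 × Fin 4) (x : Fin n → (Fin 4 → ℤ)) (R : ℕ),
      (∀ i, (q i).1 < (q i).2) → 1 ≤ R → ⌈β ^ θ⌉₊ ≤ R + 2 → (R : ℝ) * Transport.uRec β ≤ ℓ₁ → 4 * R + 8 ≤ L →
      (∀ i j : Fin n, i ≠ j → ∃ k : Fin 4,
        (2 * (R : ℤ) + 4) ≤ |((((x i k - x j k : ℤ) : ZMod (2 * L + 1))).valMinAbs : ℤ)|) →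
      ∀ T : Finset (Fin n),
        torusE (Matrix.specialUnitaryGroup (Fin 2) ℂ) (fundamentalLatticeRep 2) β L
          (fun U => Real.exp (((2 : ℕ) : ℝ) * ∑ i ∈ T, carrierCl (fundamentalLatticeRep 2) C 1 1 R (q i) (x i) U)) ≤
          Real.exp (B * T.card)) :=
  ⟨classicalMomentsFemtoTail_guard_transfer (θ₁ := 1 / 9) (by norm_num) (by norm_num) θ,
    classicalMomentsFemtoTail_guard_transfer hθ hθ₈ (1 / 9)⟩

end Summit.QuantumFields.YangMills.Cruxes.UVSeamRec.ClassicalResponse.ColdWall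

end
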